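import Summits.QuantumFields.QCD.Theses.HeatSlicedQuarks
import Literature.MathematicalPhysics.QuantumLattice.WilsonDiracAP
import Literature.MathematicalPhysics.QuantumFieldTheory.WilsonOddRPKernel
import Summits.QuantumFields.QCD.Theorems.QuarksAsStableActionMarginalSiteRP
import Summits.QuantumFields.QCD.Theorems.HeatSlicedQuarksInterleavedFlowProperStubFineWeightAdmissibleSymm
import Summits.QuantumFields.QCD.Theorems.HeatSlicedQuarksInterleavedFlowProperStubFineWeightAdmissibleOddGram
import Summits.QuantumFields.QCD.Theorems.HeatSlicedQuarksInterleavedFlowProperStubFineWeightAdmissibleOddGramRegularity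
import HarnessLib

/-!
# Fine-weight admissibility, part 5: reflection positivity of the all-axes-antiperiodic
quark-integrated Wilson weight on the odd torus
(crux stmt-QuantumFields-18031 `HeatSlicedQuarks.InterleavedFlowProper`, line `Sketch`,
stub `stub_fineWeightAdmissible`, clause (6))

Clause (6) of the admissibility predicate `AdmAt` of `HeavyThresholdYMBridge.RobustYangMillsRG`
for the fine weight of the line: on the four-torus of ODD side `2S + 1 ≥ 3`, at `β ≥ 0` and bare
masses `m_f > -1`, the signed real weight `w(U) = exp(-β S_W(U)) Re ∏_f det D_AP[U, m_f]`
(`N_f` flavours of `r = 1` Wilson quarks antiperiodic in all four directions) is reflection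
positive for the tree's link time reflection `Θ` (`GaugeConfig.timeReflect`, `t ↦ 1 - t`) on
bounded measurable positive-time link functions `F` (`IsPositiveTimeObservable`; gauge invariance
is not needed): `0 ≤ ∫ F(ΘU) F(U) w(U) ∏ dU_e` (`fineWeight_rp`).

Proof. On the odd torus `Θ` fixes the layer of temporal links `0 → 1` (crossing links) and the
site slice `t = S + 1` (shared links); the tree's abstract kernel mechanism
`WilsonOddRP.integral_oddCovKernel_nonneg` (Osterwalder–Seiler split of the crossing links,
conditioning on the shared slice, Gram expansion of the crossing plaquettes) reduces reflection
positivity of `exp(-β S_W) · Φ` to a covariant Gram form of `Φ` with a positive semidefinite kernel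
on the shared slice. The fermionic Gram form is `exists_oddGramData` (parts 2–4: Lüscher's
transfer-matrix formula for `det D_AP`, the splitting of the transfer product of the odd circle at
the crossing layer and the shared slice, Cauchy–Binet), one factor per flavour; the product over
flavours is a Gram form for the Kronecker-product kernel (Schur product theorem,
`Summit.QuantumFields.QCD.Theorems.posSemidef_piProd`), and the observable contributes the factor
`F(z) conj F(ΘU)`. All statements are proved; no definitions.

References: K. Osterwalder, E. Seiler, Ann. Phys. 110 (1978) 440, §2; M. Lüscher, Commun. Math.
Phys. 54 (1977) 283, §3; I. Montvay, G. Münster, *Quantum Fields on a Lattice* (1994) §4.2.3.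
-/

noncomputable section

-- The Gram index types are too deep for the default instance-search size bound, as in the tree's
-- `QuarksAsStableActionMarginalSiteRP`.
set_option synthInstance.maxSize 512

namespace Summit.QuantumFields.QCD.Cruxes.InterleavedFlowProper.OffsetLastFormatHandover

open Literature.MathematicalPhysics.QuantumFieldTheory Literature.MathematicalPhysics.QuantumLattice
  Literature.MathematicalPhysics.AQFT
open Literature.Probability.LatticeModels Literature.LinearAlgebra.Matrix
open Filter Topology MeasureTheory Matrix Complex Finset
open scoped ComplexOrder ComplexConjugate

namespace FineWeight

/-! ## Packaging: the single-flavour Gram data -/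

section Packaging

variable {S N : ℕ} [NeZero N]

/-- **The odd-torus Gram data of one quark flavour** (`m > -1`, `S ≥ 1`): bounded measurable
features `Φ_q` depending only on the links of `oPosEdges ∪ lowerEdges` and a bounded measurable,
pointwise positive semidefinite kernel `K` depending only on the links of `oSharedEdges`, such
that `det D_AP[translateLow Y U, m] = ∑_{q', q} Φ_{q'}(splice (U, Y)) K_{q' q}(U) conj Φ_q(ΘU)`
for all `U, Y` — the fermionic input of the odd-torus kernel mechanism
`WilsonOddRP.integral_oddCovKernel_nonneg`. -/
theorem exists_oddGramData (hS : 1 ≤ S) {m : ℝ} (hm : -1 < m) :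
    ∃ (Φ : (((((Fin 3 → ZMod (2 * S + 1)) × Fin N) × Fin 2) ⊕ (((Fin 3 → ZMod (2 * S + 1)) × Fin N) × Fin 2)) →
        (((((Fin 3 → ZMod (2 * S + 1)) × Fin N) × Fin 2) ⊕ (((Fin 3 → ZMod (2 * S + 1)) × Fin N) × Fin 2)) ⊕
          ((((Fin 3 → ZMod (2 * S + 1)) × Fin N) × Fin 2) ⊕ (((Fin 3 → ZMod (2 * S + 1)) × Fin N) × Fin 2)))) →
        GaugeConfig 4 (2 * S + 1) (Matrix.specialUnitaryGroup (Fin N) ℂ) → ℂ)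
      (K : (((((Fin 3 → ZMod (2 * S + 1)) × Fin N) × Fin 2) ⊕ (((Fin 3 → ZMod (2 * S + 1)) × Fin N) × Fin 2)) →
        (((((Fin 3 → ZMod (2 * S + 1)) × Fin N) × Fin 2) ⊕ (((Fin 3 → ZMod (2 * S + 1)) × Fin N) × Fin 2)) ⊕
          ((((Fin 3 → ZMod (2 * S + 1)) × Fin N) × Fin 2) ⊕ (((Fin 3 → ZMod (2 * S + 1)) × Fin N) × Fin 2)))) →
        (((((Fin 3 → ZMod (2 * S + 1)) × Fin N) × Fin 2) ⊕ (((Fin 3 → ZMod (2 * S + 1)) × Fin N) × Fin 2)) →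
        (((((Fin 3 → ZMod (2 * S + 1)) × Fin N) × Fin 2) ⊕ (((Fin 3 → ZMod (2 * S + 1)) × Fin N) × Fin 2)) ⊕
          ((((Fin 3 → ZMod (2 * S + 1)) × Fin N) × Fin 2) ⊕ (((Fin 3 → ZMod (2 * S + 1)) × Fin N) × Fin 2)))) →
        GaugeConfig 4 (2 * S + 1) (Matrix.specialUnitaryGroup (Fin N) ℂ) → ℂ),
      (∀ q, Measurable (Φ q)) ∧ (∀ q' q, Measurable (K q' q)) ∧
      (∃ C : ℝ, ∀ q V, ‖Φ q V‖ ≤ C) ∧ (∃ C : ℝ, ∀ q' q V, ‖K q' q V‖ ≤ C) ∧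
      (∀ q, DependsOn (Φ q)
        ((WilsonOddRP.oPosEdges ∪ WilsonOddRP.lowerEdges : Finset (Edge 4 (2 * S + 1))) : Set (Edge 4 (2 * S + 1)))) ∧
      (∀ q' q, DependsOn (K q' q) ((WilsonOddRP.oSharedEdges : Finset (Edge 4 (2 * S + 1))) : Set (Edge 4 (2 * S + 1)))) ∧
      (∀ V, (Matrix.of fun q' q => K q' q V).PosSemidef) ∧
      ∀ U Y, fermionDet (wilsonDiracAP (WilsonOddRP.translateLow Y U) m) =
        ∑ q', ∑ q, Φ q' (LatticeRP.splice WilsonOddRP.lowerEdges (U, Y)) * K q' q U *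
          (starRingEnd ℂ) (Φ q U.timeReflect) := by
  -- the slice data and the Gram data, as functions
  set A : GaugeConfig 4 (2 * S + 1) (Matrix.specialUnitaryGroup (Fin N) ℂ) → Fin (2 * S + 1) →
      Matrix (((Fin 3 → ZMod (2 * S + 1)) × Fin N) × Fin 2) (((Fin 3 → ZMod (2 * S + 1)) × Fin N) × Fin 2) ℂ :=
    fun V t => sliceDiag (unitaryFundamentalRep (Fin N) ℂ) (apLift V) m t with hA
  set Ys : GaugeConfig 4 (2 * S + 1) (Matrix.specialUnitaryGroup (Fin N) ℂ) → Fin (2 * S + 1) →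
      Matrix ((((Fin 3 → ZMod (2 * S + 1)) × Fin N) × Fin 2) ⊕ (((Fin 3 → ZMod (2 * S + 1)) × Fin N) × Fin 2))
        ((((Fin 3 → ZMod (2 * S + 1)) × Fin N) × Fin 2) ⊕ (((Fin 3 → ZMod (2 * S + 1)) × Fin N) × Fin 2)) ℂ :=
    fun V t => transferStep (A V t) (sliceOff (unitaryFundamentalRep (Fin N) ℂ) (apLift V) t) (A V t) with hYs
  set W : GaugeConfig 4 (2 * S + 1) (Matrix.specialUnitaryGroup (Fin N) ℂ) → Fin (2 * S + 1) →
      Matrix ((((Fin 3 → ZMod (2 * S + 1)) × Fin N) × Fin 2) ⊕ (((Fin 3 → ZMod (2 * S + 1)) × Fin N) × Fin 2))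
        ((((Fin 3 → ZMod (2 * S + 1)) × Fin N) × Fin 2) ⊕ (((Fin 3 → ZMod (2 * S + 1)) × Fin N) × Fin 2)) ℂ :=
    fun V t => linkBlock (sliceLink (unitaryFundamentalRep (Fin N) ℂ) (unitaryLift V) t) with hW
  set G : GaugeConfig 4 (2 * S + 1) (Matrix.specialUnitaryGroup (Fin N) ℂ) →
      Matrix ((((Fin 3 → ZMod (2 * S + 1)) × Fin N) × Fin 2) ⊕ (((Fin 3 → ZMod (2 * S + 1)) × Fin N) × Fin 2))
        ((((Fin 3 → ZMod (2 * S + 1)) × Fin N) × Fin 2) ⊕ (((Fin 3 → ZMod (2 * S + 1)) × Fin N) × Fin 2)) ℂ :=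
    fun V => (List.ofFn fun s : Fin (S + 1) =>
      (W V (Fin.castLE (by omega) s))ᴴ * (if (s : ℕ) = 0 then 1 else Ys V (Fin.castLE (by omega) s))).reverse.prod with hG
  set c : GaugeConfig 4 (2 * S + 1) (Matrix.specialUnitaryGroup (Fin N) ℂ) → ℂ :=
    fun V => ∏ s : Fin S, (A V (Fin.castLE (by omega) s.succ)).det with hc
  have hA' : ∀ V t, A V t = sliceDiag (unitaryFundamentalRep (Fin N) ℂ) (apLift V) m t := fun _ _ => rfl
  have hYs' : ∀ V t, Ys V t = transferStep (A V t) (sliceOff (unitaryFundamentalRep (Fin N) ℂ) (apLift V) t) (A V t) :=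
    fun _ _ => rfl
  have hW' : ∀ V t, W V t = linkBlock (sliceLink (unitaryFundamentalRep (Fin N) ℂ) (unitaryLift V) t) := fun _ _ => rfl
  have hG' : ∀ V, G V = (List.ofFn fun s : Fin (S + 1) =>
      (W V (Fin.castLE (by omega) s))ᴴ * (if (s : ℕ) = 0 then 1 else Ys V (Fin.castLE (by omega) s))).reverse.prod :=
    fun _ => rfl
  have hc' : ∀ V, c V = ∏ s : Fin S, (A V (Fin.castLE (by omega) s.succ)).det := fun _ => rfl
  refine ⟨fun q V => c V * gramFeature (G V) q,
    fun q' q V => (A V ⟨S + 1, by omega⟩).det * gramCoupling 1 (Ys V ⟨S + 1, by omega⟩) q' q,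
    fun q => measurable_gramFeature' A hA' Ys W hYs' hW' G hG' c hc' hm q,
    fun q' q => measurable_gramCoupling' A hA' Ys hYs' hS hm q' q,
    exists_bound_gramFeature' A hA' Ys W hYs' hW' G hG' c hc' hm,
    exists_bound_gramCoupling' A hA' Ys hYs' hS hm,
    fun q U V hUV => gramFeature_congr' A hA' Ys W hYs' hW' G hG' c hc' (fun e he1 he2 => hUV e ?_) q,
    fun q' q U V hUV => gramCoupling_congr' A hA' Ys hYs' hS (fun e he1 he2 => hUV e ?_) q' q,
    fun V => posSemidef_gramCoupling' A hA' Ys hYs' hS hm V,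
    fun U Y => fermionDet_wilsonDiracAP_translateLow_eq_sum_gram hS U Y hm A hA' Ys W hYs' hW' G hG' c hc'⟩
  · -- the feature's links lie in `oPosEdges ∪ lowerEdges`
    rw [Finset.coe_union, Set.mem_union, Finset.mem_coe, Finset.mem_coe, WilsonOddRP.mem_oPosEdges,
      WilsonOddRP.mem_lowerEdges, WilsonOddRP.IsOPosEdge, WilsonRP.IsLowerCross]
    rcases he2 with h0 | h1
    · by_cases h : 1 ≤ (e.1 0).val
      · exact Or.inl ⟨h, by omega⟩
      · exact Or.inr ⟨h0, by omega⟩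
    · exact Or.inl ⟨h1, by omega⟩
  · -- the kernel's links lie in `oSharedEdges`
    rw [Finset.mem_coe, WilsonOddRP.mem_oSharedEdges, WilsonOddRP.IsOSharedEdge]
    exact ⟨he1, by omega⟩

end Packaging

end FineWeight
/-! ## Clause (6): reflection positivity of the fine weight on the odd torus -/

section RP

open FineWeight

/-- A positive semidefinite matrix gives a non-negative Hermitian form `∑_{I,J} x_I conj x_J P_{IJ}`
(the pointwise positivity hypothesis of the kernel mechanism). -/
theorem sum_mul_conj_mul_nonneg_of_posSemidef {𝓘 : Type*} [Fintype 𝓘] {P : Matrix 𝓘 𝓘 ℂ}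
    (hP : P.PosSemidef) (x : 𝓘 → ℂ) : 0 ≤ ∑ I, ∑ J, x I * conj (x J) * P I J := by
  have h := (Matrix.posSemidef_iff_dotProduct_mulVec.mp hP).2 (fun J => conj (x J))
  convert h using 1
  simp only [dotProduct, Matrix.mulVec, Pi.star_apply, RCLike.star_def, Complex.conj_conj, Finset.mul_sum]
  exact Finset.sum_congr rfl fun I _ => Finset.sum_congr rfl fun J _ => by ring

/-- A positive-time observable (both endpoints of every link it depends on in `1 ≤ t ≤ L/2`) does
not see the crossing links `0 → 1`, nor their images under the split or the splice, and neither
does its reflection. -/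
theorem positiveTime_translateLow {L : ℕ} [NeZero L] {G α : Type*} [Group G] {F : GaugeConfig 4 L G → α}
    (hF : IsPositiveTimeObservable F) (Y U : GaugeConfig 4 L G) :
    F (WilsonOddRP.translateLow Y U) = F U ∧ F (LatticeRP.splice WilsonOddRP.lowerEdges (U, Y)) = F U ∧
      F (WilsonOddRP.translateLow Y U).timeReflect = F U.timeReflect := by
  have hnc : ∀ e : Edge 4 L, 1 ≤ (e.1 0).val → ¬ WilsonRP.IsLowerCross e := fun e he hc => by
    rw [WilsonRP.IsLowerCross] at hc; omega
  refine ⟨hF _ _ fun e h1 _ _ _ => WilsonOddRP.translateLow_apply_of_not_isLowerCross Y U (hnc e h1),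
    hF _ _ fun e h1 _ _ _ => WilsonOddRP.splice_apply_of_not_isLowerCross U Y (hnc e h1),
    hF _ _ fun e h1 _ _ _ => ?_⟩
  have hne : ¬ WilsonRP.IsLowerCross (WilsonRP.edgeReflect e) := fun hc => by
    have h := WilsonOddRP.edgeReflect_of_isLowerCross (d := 4) (L := L) hc
    rw [WilsonRP.edgeReflect_edgeReflect] at h
    rw [← h] at hc
    exact hnc e h1 hc
  rw [WilsonRP.timeReflect_apply, WilsonRP.timeReflect_apply,
    WilsonOddRP.translateLow_apply_of_not_isLowerCross Y U hne]

/-- A positive-time observable depends only on the links of `P ∪ C ∪ M` of the odd-torus mechanism. -/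
theorem positiveTime_dependsOn {L : ℕ} [NeZero L] {G α : Type*} {F : GaugeConfig 4 L G → α}
    (hF : IsPositiveTimeObservable F) :
    DependsOn F ((WilsonOddRP.oPosEdges ∪ WilsonOddRP.lowerEdges ∪ WilsonOddRP.oSharedEdges :
      Finset (Edge 4 L)) : Set (Edge 4 L)) := fun U V hUV =>
  hF U V fun e h1 h2 _ _ => hUV e (by
    rw [Finset.coe_union, Finset.coe_union, Set.mem_union, Set.mem_union, Finset.mem_coe,
      WilsonOddRP.mem_oPosEdges]
    exact Or.inl (Or.inl ⟨h1, h2⟩))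

/-- The flavour product of antiperiodic determinants is a real number. -/
theorem prod_fermionDet_wilsonDiracAP_eq_re {L Nf : ℕ} [NeZero L] (U : GaugeConfig 4 L (Matrix.specialUnitaryGroup (Fin 3) ℂ))
    (mq : Fin Nf → ℝ) :
    (∏ f, fermionDet (wilsonDiracAP U (mq f))) = (((∏ f, fermionDet (wilsonDiracAP U (mq f))).re : ℝ) : ℂ) := by
  refine (Complex.conj_eq_iff_re.1 ?_).symm
  rw [map_prod]
  exact Finset.prod_congr rfl fun f _ => star_fermionDet_wilsonDiracAP U (mq f)

/-- **Clause (6): reflection positivity of the all-axes-antiperiodic quark-integrated Wilson weight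
on the odd torus `(ℤ/(2S+1))⁴`** for the link reflection `Θ` (`GaugeConfig.timeReflect`) on bounded
measurable positive-time link functions (`β ≥ 0`, `m_f > -1`, `S ≥ 1`): the fermionic Gram data of
the `N_f` flavours (`exists_oddGramData`, Kronecker product over flavours by the Schur product theorem)
and the observable `F` feed the odd-torus kernel mechanism `WilsonOddRP.integral_oddCovKernel_nonneg`
of the tree (Osterwalder–Seiler 1978 §2; Lüscher 1977; Montvay–Münster §4.2.3). -/
theorem fineWeight_rp {Nf : ℕ} (β : ℝ) (mq : Fin Nf → ℝ) (hβ : 0 ≤ β) (hmq : ∀ f, -1 < mq f) (S : ℕ) (hS : 1 ≤ S)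
    (F : GaugeConfig 4 (2 * S + 1) (Matrix.specialUnitaryGroup (Fin 3) ℂ) → ℝ) (hF : Measurable F)
    (hFb : ∃ C, ∀ U, |F U| ≤ C) (hFpos : IsPositiveTimeObservable F) :
    0 ≤ ∫ U : GaugeConfig 4 (2 * S + 1) (Matrix.specialUnitaryGroup (Fin 3) ℂ),
      F U.timeReflect * F U * (Real.exp (-(β * wilsonAction (fundamentalRep (Fin 3)) U)) *
        (∏ f, fermionDet (wilsonDiracAP U (mq f))).re)
        ∂(Measure.pi fun _ => haarProbability (Matrix.specialUnitaryGroup (Fin 3) ℂ)) := by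
  classical
  haveI : Fact (1 < 2 * S + 1) := ⟨by omega⟩
  have hodd : Odd (2 * S + 1) := ⟨S, rfl⟩
  -- the Gram data of the flavours
  choose Φ K hΦm hKm hΦb hKb hΦdep hKdep hKpsd hgram using
    fun f => exists_oddGramData (S := S) (N := 3) hS (hmq f)
  choose CΦ hCΦ using hΦb
  choose CK hCK using hKb
  obtain ⟨B, hB⟩ := hFb
  have hB0 : 0 ≤ B := (abs_nonneg _).trans (hB (fun _ => 1))
  -- the data of the mechanism
  set g : (Fin Nf → ((((Fin 3 → ZMod (2 * S + 1)) × Fin 3) × Fin 2) ⊕ (((Fin 3 → ZMod (2 * S + 1)) × Fin 3) × Fin 2)) →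
      (((((Fin 3 → ZMod (2 * S + 1)) × Fin 3) × Fin 2) ⊕ (((Fin 3 → ZMod (2 * S + 1)) × Fin 3) × Fin 2)) ⊕
        ((((Fin 3 → ZMod (2 * S + 1)) × Fin 3) × Fin 2) ⊕ (((Fin 3 → ZMod (2 * S + 1)) × Fin 3) × Fin 2)))) →
      GaugeConfig 4 (2 * S + 1) (Matrix.specialUnitaryGroup (Fin 3) ℂ) → ℂ :=
    fun I V => (F V : ℂ) * ∏ f, Φ f (I f) V with hg
  set Pk : (Fin Nf → ((((Fin 3 → ZMod (2 * S + 1)) × Fin 3) × Fin 2) ⊕ (((Fin 3 → ZMod (2 * S + 1)) × Fin 3) × Fin 2)) →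
      (((((Fin 3 → ZMod (2 * S + 1)) × Fin 3) × Fin 2) ⊕ (((Fin 3 → ZMod (2 * S + 1)) × Fin 3) × Fin 2)) ⊕
        ((((Fin 3 → ZMod (2 * S + 1)) × Fin 3) × Fin 2) ⊕ (((Fin 3 → ZMod (2 * S + 1)) × Fin 3) × Fin 2)))) →
      (Fin Nf → ((((Fin 3 → ZMod (2 * S + 1)) × Fin 3) × Fin 2) ⊕ (((Fin 3 → ZMod (2 * S + 1)) × Fin 3) × Fin 2)) →
      (((((Fin 3 → ZMod (2 * S + 1)) × Fin 3) × Fin 2) ⊕ (((Fin 3 → ZMod (2 * S + 1)) × Fin 3) × Fin 2)) ⊕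
        ((((Fin 3 → ZMod (2 * S + 1)) × Fin 3) × Fin 2) ⊕ (((Fin 3 → ZMod (2 * S + 1)) × Fin 3) × Fin 2)))) →
      GaugeConfig 4 (2 * S + 1) (Matrix.specialUnitaryGroup (Fin 3) ℂ) → ℂ :=
    fun I J V => ∏ f, K f (I f) (J f) V with hPk
  set Φfull : GaugeConfig 4 (2 * S + 1) (Matrix.specialUnitaryGroup (Fin 3) ℂ) → ℂ :=
    fun V => ((F V.timeReflect * F V : ℝ) : ℂ) * ∏ f, fermionDet (wilsonDiracAP V (mq f)) with hΦfull
  -- the kernel mechanism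
  have key := WilsonOddRP.integral_oddCovKernel_nonneg (fundamentalRep (Fin 3)) hodd (continuous_fundamentalRep (Fin 3)) hβ
    (𝓘 := Fin Nf → ((((Fin 3 → ZMod (2 * S + 1)) × Fin 3) × Fin 2) ⊕ (((Fin 3 → ZMod (2 * S + 1)) × Fin 3) × Fin 2)) →
      (((((Fin 3 → ZMod (2 * S + 1)) × Fin 3) × Fin 2) ⊕ (((Fin 3 → ZMod (2 * S + 1)) × Fin 3) × Fin 2)) ⊕
        ((((Fin 3 → ZMod (2 * S + 1)) × Fin 3) × Fin 2) ⊕ (((Fin 3 → ZMod (2 * S + 1)) × Fin 3) × Fin 2))))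
    (g := g) (Pk := Pk) (Kg := max (B * ∏ f, CΦ f) (∏ f, CK f)) (Φ := Φfull)
    (fun I => (Complex.measurable_ofReal.comp hF).mul (Finset.measurable_prod _ fun f _ => hΦm f (I f)))
    (fun I J => Finset.measurable_prod _ fun f _ => hKm f (I f) (J f))
    (fun I V => by
      rw [hg, norm_mul, Complex.norm_real, Real.norm_eq_abs]
      exact (mul_le_mul (hB V) (Summit.QuantumFields.QCD.Theorems.norm_prod_le_prod_of_le fun f => hCΦ f (I f) V)
        (norm_nonneg _) hB0).trans (le_max_left _ _))
    (fun I J V => (Summit.QuantumFields.QCD.Theorems.norm_prod_le_prod_of_le fun f => hCK f (I f) (J f) V).trans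
      (le_max_right _ _))
    (fun I U V hUV => by
      simp only [hg, positiveTime_dependsOn hFpos hUV, fun f => hΦdep f (I f) (fun e he => hUV e (by
        rw [Finset.coe_union, Set.mem_union]; exact Or.inl he))])
    (fun I J U V hUV => by simp only [hPk, fun f => hKdep f (I f) (J f) hUV])
    (fun V x => by
      simp only [hPk]
      have hpsd := Summit.QuantumFields.QCD.Theorems.posSemidef_piProd (fun f => Matrix.of fun q' q => K f q' q V)
        fun f => hKpsd f V
      simp only [Matrix.of_apply] at hpsd
      have h := sum_mul_conj_mul_nonneg_of_posSemidef hpsd x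
      simpa only [Matrix.of_apply] using h)
    (((Complex.measurable_ofReal.comp ((hF.comp WilsonRP.measurable_timeReflect).mul hF)).mul
      (Finset.measurable_prod _ fun f _ => measurable_fermionDet_wilsonDiracAP (mq f))))
    (fun U Y => by
      obtain ⟨h1, h2, h3⟩ := positiveTime_translateLow hFpos Y U
      simp only [hΦfull, hg, hPk, h1, h2, h3, hgram _ U Y]
      rw [Fintype.prod_sum]
      simp only [Finset.mul_sum]
      refine Finset.sum_congr rfl fun I _ => ?_
      rw [Fintype.prod_sum, Finset.mul_sum]
      refine Finset.sum_congr rfl fun J _ => ?_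
      rw [Finset.prod_mul_distrib, Finset.prod_mul_distrib, map_mul, map_prod, Complex.conj_ofReal]
      push_cast
      ring)
  -- back to the real integral
  have hpt : ∀ U : GaugeConfig 4 (2 * S + 1) (Matrix.specialUnitaryGroup (Fin 3) ℂ),
      ((F U.timeReflect * F U * (Real.exp (-(β * wilsonAction (fundamentalRep (Fin 3)) U)) *
        (∏ f, fermionDet (wilsonDiracAP U (mq f))).re) : ℝ) : ℂ) =
      (Real.exp (-β * wilsonAction (fundamentalRep (Fin 3)) U) : ℂ) * Φfull U := fun U => by
    have hr := prod_fermionDet_wilsonDiracAP_eq_re U mq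
    simp only [hΦfull]
    conv_rhs => rw [hr]
    rw [neg_mul]
    push_cast
    ring
  rw [← Complex.zero_le_real, ← integral_complex_ofReal]
  simp_rw [hpt]
  exact key

end RP

section Registered

/-- **Registered sub-goal `stubFW_rp` of `stub_fineWeightAdmissible`**: clause (6), reflection
positivity of the all-axes-antiperiodic quark-integrated Wilson weight on the odd torus for the link
time reflection, on bounded measurable positive-time link functions. -/
theorem stubFW_rp : ∀ (Nf : ℕ) (β : ℝ) (mq : Fin Nf → ℝ), 0 ≤ β → (∀ f, -1 < mq f) → ∀ (S : ℕ), 1 ≤ S →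
    ∀ F : GaugeConfig 4 (2 * S + 1) (Matrix.specialUnitaryGroup (Fin 3) ℂ) → ℝ, Measurable F → (∃ C, ∀ U, |F U| ≤ C) →
    IsPositiveTimeObservable F →
    0 ≤ ∫ U : GaugeConfig 4 (2 * S + 1) (Matrix.specialUnitaryGroup (Fin 3) ℂ),
      F U.timeReflect * F U * (Real.exp (-(β * wilsonAction (fundamentalRep (Fin 3)) U)) *
        (∏ f, fermionDet (wilsonDiracAP U (mq f))).re)
        ∂(Measure.pi fun _ => haarProbability (Matrix.specialUnitaryGroup (Fin 3) ℂ)) :=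
  fun _ β mq hβ hmq S hS F hF hFb hFpos => fineWeight_rp β mq hβ hmq S hS F hF hFb hFpos

end Registered

end Summit.QuantumFields.QCD.Cruxes.InterleavedFlowProper.OffsetLastFormatHandover

end
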